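import Summits.QuantumFields.BalabanUV.T4Continuum.Support.NE3StraightAverageSplit
import HarnessLib

/-!
# T⁴ programme, node NE3 — row E-MLw-(w4)-P, slice file Φ2′b: THE FRAME-FREE SLICE'S DIVERGENCE CONDITION IS AN ORTHOGONALITY,
# hence slice fields are NORM-MINIMAL in their block-mean-zero corner-trivial gauge orbit (flat, complex values)

NE3 (node U1b), row NE3 OWNER `b2b-balaban-t4-ne3-p1` (gen 21), ruling ρ-g21-3 (journal l.16063, note `g21/D-ne3p1-g21-2.md`) and
FINDING F-ne3p1-g21-1 §2 (journal l.16394, memo `g21/F-ne3p1-g21-1.md`), row Φ2′b.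

WHY.  The curved core of (ML_w) is built on the frame-free slice `T_♮(W) = {Y tangent : framePot_W Y = 0, D_W^* Y blockwise
constant off corners}`.  The gradient-free flat proof of the Poincaré inequality on `T_♮` (memo §2) splits `Y = Y_L + dζ` and
bounds the exact part by ANY competitor with the same corner values and block means — because the slice's divergence clause says
precisely that `Y` is ℓ²-orthogonal to `dPot ξ` for every corner-trivial, block-sum-zero `ξ`, hence norm-minimal in `Y + dPot Ξ₀₀`.
THIS FILE proves that orthogonality and minimality at the flat background (0 def, 0 sorry):
* **`sum_inner_dPot_eq_neg_sum_inner_flatDiv`** — periodic summation by parts in all directions: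
  `Σ_x Σ_κ ⟪dPot ξ x κ, Y x κ⟫ = −Σ_x ⟪ξ x, Σ_κ (Y x κ − Y (x − e_κ) κ)⟫` (from (70S) `sum_inner_fd_eq_neg`);
* **`sum_inner_eq_zero_of_blockConst`** — if a site function `D` is constant on each block off its corner and `ξ` vanishes at the
  corners and has zero block sums, then `Σ_x ⟪ξ x, D x⟫ = 0`;
* **`sum_inner_dPot_eq_zero_of_slice`** — hence `Σ_x Σ_κ ⟪dPot ξ x κ, Y x κ⟫ = 0` when `flatDiv Y` is blockwise constant off corners;
* **`sum_norm_sq_le_of_slice`** — and `Σ_x Σ_κ ‖Y x κ‖² ≤ Σ_x Σ_κ ‖Y x κ + dPot ξ x κ‖²` (Pythagoras): slice fields are norm-minimal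
  in their `dPot Ξ₀₀`-orbit.

HONEST FRAMING.  Linear algebra ∕ lattice bookkeeping of OUR slice at the FLAT configuration; nothing about Bałaban's minimisers,
(P_W), (ML_w), T-E_w or NE3 is asserted; NE3 NOT proved; spine PROVED 0∕9; finite T⁴ rung (B)+1 — NOT infinite volume, NOT mass
gap, NOT BetaPertH, NOT Clay.  ABSOLUTE RULE kept (nothing printed is a hypothesis).  PLACEMENT: `Summits/QuantumFields/BalabanUV/`;
imports (70S) only.
-/

set_option autoImplicit false

open scoped BigOperators InnerProductSpace
open Finset

namespace Summit.QuantumFields.BalabanUV.T4Continuum.NE3SliceOrthogonality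

open Literature.MathematicalPhysics.QuantumFieldTheory.Balaban1983to89
open B7Prop1Explicit
open T4AveragingDeficitWallBoundary (periodBox mem_periodBox)
open NE3TangentNoGoWords (dPot)
open NE3BlockLineAverage (sum_periodBox_blocks)
open NE3StraightAverageSplit (sum_inner_fd_eq_neg)

noncomputable section

variable {d : ℕ}

/-! ## §1 Summation by parts in all directions -/

/-- **PERIODIC SUMMATION BY PARTS, ALL DIRECTIONS** (complex values): for `P`-periodic `ξ` and `Y`,
`Σ_{x∈periodBox P} Σ_κ ⟪dPot ξ x κ, Y x κ⟫ = −Σ_x ⟪ξ x, Σ_κ (Y x κ − Y (x − e_κ) κ)⟫`. [folklore] -/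
theorem sum_inner_dPot_eq_neg_sum_inner_flatDiv {P : ℕ} (hP : 1 ≤ P) (ξ : Site d → ℂ) (Y : Site d → Fin d → ℂ)
    (hξ : ∀ (x : Site d) (τ : Fin d), ξ (x + (P : ℤ) • e τ) = ξ x)
    (hY : ∀ (x : Site d) (τ μ : Fin d), Y (x + (P : ℤ) • e τ) μ = Y x μ) :
    ∑ x ∈ periodBox (d := d) P, ∑ κ : Fin d, ⟪dPot ξ x κ, Y x κ⟫_ℝ
      = -∑ x ∈ periodBox (d := d) P, ⟪ξ x, ∑ κ : Fin d, (Y x κ - Y (x - e κ) κ)⟫_ℝ := by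
  rw [Finset.sum_comm]
  have hκ : ∀ κ : Fin d, ∑ x ∈ periodBox (d := d) P, ⟪dPot ξ x κ, Y x κ⟫_ℝ
      = -∑ x ∈ periodBox (d := d) P, ⟪ξ x, Y x κ - Y (x - e κ) κ⟫_ℝ := by
    intro κ
    simp only [dPot]
    exact sum_inner_fd_eq_neg hP κ ξ (fun x => Y x κ) hξ (fun x τ => hY x τ κ)
  simp_rw [hκ]
  rw [← Finset.sum_neg_distrib]
  simp_rw [← Finset.sum_neg_distrib]
  rw [Finset.sum_comm]
  refine Finset.sum_congr rfl fun x _ => ?_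
  rw [inner_sum, Finset.sum_neg_distrib]

/-! ## §2 Block-constant site functions pair to zero with corner-trivial block-sum-zero functions -/

/-- **BLOCK-CONSTANT OFF CORNERS × CORNER-TRIVIAL BLOCK-SUM-ZERO = 0**: `M, N ≥ 1`; if `D (M•z + v) = c z` for every block `z` and
every offset `v ∈ [0,M)^d ∖ {0}`, and `ξ (M•z) = 0`, `Σ_{v∈[0,M)^d} ξ (M•z + v) = 0` for every `z`, then
`Σ_{x∈periodBox (M·N)} ⟪ξ x, D x⟫ = 0`. [folklore] -/
theorem sum_inner_eq_zero_of_blockConst {M : ℕ} (hM : 1 ≤ M) (N : ℕ) (ξ D : Site d → ℂ) (c : Site d → ℂ)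
    (hD : ∀ (z v : Site d), v ∈ periodBox (d := d) M → v ≠ 0 → D ((M : ℤ) • z + v) = c z)
    (hξc : ∀ z : Site d, ξ ((M : ℤ) • z) = 0)
    (hξs : ∀ z : Site d, ∑ v ∈ periodBox (d := d) M, ξ ((M : ℤ) • z + v) = 0) :
    ∑ x ∈ periodBox (d := d) (M * N), ⟪ξ x, D x⟫_ℝ = 0 := by
  rw [← sum_periodBox_blocks M N hM (fun x => ⟪ξ x, D x⟫_ℝ)]
  refine Finset.sum_eq_zero fun z _ => ?_
  -- on the block: the corner term vanishes, the rest pairs with the constant `c z`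
  have hterm : ∀ v ∈ periodBox (d := d) M, ⟪ξ ((M : ℤ) • z + v), D ((M : ℤ) • z + v)⟫_ℝ
      = ⟪ξ ((M : ℤ) • z + v), c z⟫_ℝ := by
    intro v hv
    by_cases h0 : v = 0
    · subst h0; rw [add_zero, hξc z, inner_zero_left, inner_zero_left]
    · rw [hD z v hv h0]
  rw [Finset.sum_congr rfl hterm, ← sum_inner, hξs z, inner_zero_left]

/-! ## §3 The slice's divergence clause as an orthogonality; norm-minimality -/

/-- **ORTHOGONALITY OF SLICE FIELDS TO THE BLOCK-MEAN-ZERO CORNER-TRIVIAL GAUGE MODES** (flat, complex): `M, N ≥ 1`, `Y` and `ξ`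
`(M·N)`-periodic; if the flat divergence `x ↦ Σ_κ (Y x κ − Y (x − e_κ) κ)` is constant on each block off its corner, and `ξ`
vanishes at the block corners with zero block sums, then `Σ_x Σ_κ ⟪dPot ξ x κ, Y x κ⟫ = 0`. [folklore] -/
theorem sum_inner_dPot_eq_zero_of_slice {M : ℕ} (hM : 1 ≤ M) {N : ℕ} (hN : 1 ≤ N) (ξ : Site d → ℂ)
    (Y : Site d → Fin d → ℂ) (c : Site d → ℂ)
    (hξ : ∀ (x : Site d) (τ : Fin d), ξ (x + ((M * N : ℕ) : ℤ) • e τ) = ξ x)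
    (hY : ∀ (x : Site d) (τ μ : Fin d), Y (x + ((M * N : ℕ) : ℤ) • e τ) μ = Y x μ)
    (hdiv : ∀ (z v : Site d), v ∈ periodBox (d := d) M → v ≠ 0 →
      ∑ κ : Fin d, (Y ((M : ℤ) • z + v) κ - Y ((M : ℤ) • z + v - e κ) κ) = c z)
    (hξc : ∀ z : Site d, ξ ((M : ℤ) • z) = 0)
    (hξs : ∀ z : Site d, ∑ v ∈ periodBox (d := d) M, ξ ((M : ℤ) • z + v) = 0) :
    ∑ x ∈ periodBox (d := d) (M * N), ∑ κ : Fin d, ⟪dPot ξ x κ, Y x κ⟫_ℝ = 0 := by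
  have hMN : 1 ≤ M * N := Nat.one_le_iff_ne_zero.mpr (Nat.mul_ne_zero (by omega) (by omega))
  rw [sum_inner_dPot_eq_neg_sum_inner_flatDiv hMN ξ Y hξ hY, neg_eq_zero]
  exact sum_inner_eq_zero_of_blockConst hM N ξ (fun x => ∑ κ : Fin d, (Y x κ - Y (x - e κ) κ)) c
    (fun z v hv h0 => hdiv z v hv h0) hξc hξs

/-- **SLICE FIELDS ARE NORM-MINIMAL IN THEIR `dPot Ξ₀₀`-ORBIT** (flat, complex): under the hypotheses of
`sum_inner_dPot_eq_zero_of_slice`, `Σ_x Σ_κ ‖Y x κ‖² ≤ Σ_x Σ_κ ‖Y x κ + dPot ξ x κ‖²` — indeed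
`Σ‖Y + dPot ξ‖² = Σ‖Y‖² + Σ‖dPot ξ‖²`. [folklore] -/
theorem sum_norm_sq_add_dPot_eq {M : ℕ} (hM : 1 ≤ M) {N : ℕ} (hN : 1 ≤ N) (ξ : Site d → ℂ)
    (Y : Site d → Fin d → ℂ) (c : Site d → ℂ)
    (hξ : ∀ (x : Site d) (τ : Fin d), ξ (x + ((M * N : ℕ) : ℤ) • e τ) = ξ x)
    (hY : ∀ (x : Site d) (τ μ : Fin d), Y (x + ((M * N : ℕ) : ℤ) • e τ) μ = Y x μ)
    (hdiv : ∀ (z v : Site d), v ∈ periodBox (d := d) M → v ≠ 0 →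
      ∑ κ : Fin d, (Y ((M : ℤ) • z + v) κ - Y ((M : ℤ) • z + v - e κ) κ) = c z)
    (hξc : ∀ z : Site d, ξ ((M : ℤ) • z) = 0)
    (hξs : ∀ z : Site d, ∑ v ∈ periodBox (d := d) M, ξ ((M : ℤ) • z + v) = 0) :
    ∑ x ∈ periodBox (d := d) (M * N), ∑ κ : Fin d, ‖Y x κ + dPot ξ x κ‖ ^ 2
      = ∑ x ∈ periodBox (d := d) (M * N), ∑ κ : Fin d, ‖Y x κ‖ ^ 2
        + ∑ x ∈ periodBox (d := d) (M * N), ∑ κ : Fin d, ‖dPot ξ x κ‖ ^ 2 := by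
  have horth := sum_inner_dPot_eq_zero_of_slice hM hN ξ Y c hξ hY hdiv hξc hξs
  have hpt : ∀ (x : Site d) (κ : Fin d),
      ‖Y x κ + dPot ξ x κ‖ ^ 2 = ‖Y x κ‖ ^ 2 + 2 * ⟪dPot ξ x κ, Y x κ⟫_ℝ + ‖dPot ξ x κ‖ ^ 2 := by
    intro x κ
    rw [norm_add_sq_real, real_inner_comm]
  simp_rw [hpt, Finset.sum_add_distrib, ← Finset.mul_sum]
  rw [horth, mul_zero, add_zero]

/-- … hence `Σ_x Σ_κ ‖Y x κ‖² ≤ Σ_x Σ_κ ‖Y x κ + dPot ξ x κ‖²`. [folklore] -/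
theorem sum_norm_sq_le_of_slice {M : ℕ} (hM : 1 ≤ M) {N : ℕ} (hN : 1 ≤ N) (ξ : Site d → ℂ)
    (Y : Site d → Fin d → ℂ) (c : Site d → ℂ)
    (hξ : ∀ (x : Site d) (τ : Fin d), ξ (x + ((M * N : ℕ) : ℤ) • e τ) = ξ x)
    (hY : ∀ (x : Site d) (τ μ : Fin d), Y (x + ((M * N : ℕ) : ℤ) • e τ) μ = Y x μ)
    (hdiv : ∀ (z v : Site d), v ∈ periodBox (d := d) M → v ≠ 0 →
      ∑ κ : Fin d, (Y ((M : ℤ) • z + v) κ - Y ((M : ℤ) • z + v - e κ) κ) = c z)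
    (hξc : ∀ z : Site d, ξ ((M : ℤ) • z) = 0)
    (hξs : ∀ z : Site d, ∑ v ∈ periodBox (d := d) M, ξ ((M : ℤ) • z + v) = 0) :
    ∑ x ∈ periodBox (d := d) (M * N), ∑ κ : Fin d, ‖Y x κ‖ ^ 2
      ≤ ∑ x ∈ periodBox (d := d) (M * N), ∑ κ : Fin d, ‖Y x κ + dPot ξ x κ‖ ^ 2 := by
  rw [sum_norm_sq_add_dPot_eq hM hN ξ Y c hξ hY hdiv hξc hξs]
  have : 0 ≤ ∑ x ∈ periodBox (d := d) (M * N), ∑ κ : Fin d, ‖dPot ξ x κ‖ ^ 2 := by positivity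
  linarith

end

end Summit.QuantumFields.BalabanUV.T4Continuum.NE3SliceOrthogonality
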